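import Mathlib.Analysis.SpecialFunctions.Pow.Real
import Mathlib.Analysis.Calculus.ContDiff.Defs
import Mathlib.MeasureTheory.Integral.Bochner.Basic
import Mathlib.MeasureTheory.Integral.IntegrableOn
import Mathlib.MeasureTheory.Measure.Lebesgue.Basic
import Mathlib.Topology.Order.IntermediateValue
import HarnessLib

/-!
# Barrier catalogue `FinalStateConjecture`: higher dimensions — the Gregory–Laflamme instability of the 5D Schwarzschild black string (Collingbourne's theorem) and black-ring non-uniqueness
(`Literature/Barriers/FinalStateConjecture/`, D-0021; family `gr`, summit `FinalStateConjecture`;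
namespace `Literature.Barriers.FinalStateConjecture`)

The final state conjecture is a statement about the `3+1`-dimensional vacuum equations
(`Literature.Geometry.Lorentzian.FinalStateDecomposition`, `Spacetime 4`): generic asymptotically flat data settle
down to finitely many **Kerr** black holes plus radiation, resting on (i) the classification of
stationary vacuum black holes by `(M, J)` (Kerr uniqueness) and (ii) their dynamical stability.
Both inputs fail for the vacuum equations `Ric(g) = 0` in dimension `D = 5`, and this file
records the printed theorems saying so, as a **barrier against dimension-blind (precisely:
flat-factor-blind) methods** (see the docstring of `GregoryLaflammeInstability` for the exact
delimitation of the technique class, narrowed at the 2026-08-14 barrier audit):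

* "In `4D` it is conjectured that maximal developments of 'generic' asymptotically flat initial
  data sets can asymptotically be described by a finite number of Kerr black holes. This 'final
  state conjecture' cannot generalize immediately since there exist at least two distinct
  families of black hole solutions that can have the same mass and angular momentum: the
  Myers–Perry black hole and the black ring. Moreover, there exist distinct black ring solutions
  with the same mass and angular momentum [H1, H2]. The final state conjecture may need to be
  modified to include the property of stability." (Collingbourne, J. Math. Phys. 62 (2021)
  032502 = arXiv:2007.08441, §1.7.2, p. 8.)
* **Theorem 1.1 (Gregory–Laflamme instability)**, ibid. §1.3: "For all
  `|ω| ∈ [3/(20M), 8/(20M)]`, there exists a non-trivial mode solution `h` of the form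
  `h_{αβ} = e^{μt + iωz} H_{αβ}(r, θ)` to the linearised vacuum Einstein equation on the exterior
  `𝓔_A` of the Schwarzschild black string background `Sch₄ × ℝ` with `μ > 1/(40√10 M) > 0`
  [...]. The solution `h` extends regularly to `𝓗⁺_A` and decays exponentially towards `i⁰_A`
  [...]. Moreover, the solution `h` is not pure gauge and can in fact be chosen such that the
  harmonic/transverse-traceless gauge conditions are satisfied. Suppose `R > 4M`, then [...]
  `h` induces a smooth solution on the exterior `𝓔_A` of the Schwarzschild black string
  `Sch₄ × 𝕊¹_R` [...] [with] finite energy. Hence, the exterior `𝓔_A` of the Schwarzschild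
  black string `Sch₄ × ℝ` or `Sch₄ × 𝕊¹_R` for `R > 4M` is linearly unstable".
* Emparan–Reall, Living Rev. Relativ. 11 (2008) 6 = arXiv:0801.3471, §5.1.1 (p. 14): for the
  balanced black ring "the phase curve `a_H(j)` can be expressed in parametric form as
  `a_H = 2√(ν(1−ν))`, `j = √((1+ν)³/(8ν))` [...]. This implies that in the range
  `√(27/32) ≤ j < 1` there exist three different solutions (thin and fat black rings, and MP
  black hole) with the same value of `j`. The notion of black hole uniqueness that was proven
  to hold in four dimensions does not extend to five dimensions."

## What is formalised

Collingbourne's proof reduces Theorem 1.1, through the spherical-gauge ansatz (Prop. 3.1),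
the decoupling to a single radial ODE for `𝔥 := H_z` (Prop. 3.2, eq. (HZ)), the exclusion of
pure gauge (Prop. 3.3) and the identification of admissible boundary behaviour (Props. 3.4,
3.6, 3.7), to Proposition 4.1: the existence, for `|ω̂| ∈ [3/10, 8/10]` (`ω̂ = 2Mω`,
`x = r/2M`, `μ̂ = 2Mμ`), of a `C^∞((1, ∞))` solution of the dimensionless ODE (HZX),
`𝔥'' + p_ω̂ 𝔥' + (q_ω̂ − μ̂² x²/(x−1)²) 𝔥 = 0`, with `μ̂ > 0` and admissible asymptotics
`k₂ = 0`, `c₁ = 0`, reformulated as Proposition 4.6 (p. 22): "For all `|ω̂| ∈ [3/10, 8/10]`,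
there exists a `C^∞(ℝ)` solution `𝔥̃` to the Schrödinger equation (ODEF) with
`μ̂ > 1/(20√10) > 0`, and [...] `k̃₂ = 0` and `c̃₁ = 0`"; §4 produces it as `𝔥 = w 𝔥̃`,
`w = (1 + ω̂² x³)/x`, where `𝔥̃`, as a function of the tortoise variable
`x_* = x + log(x − 1) ∈ ℝ`, is a smooth `H¹(ℝ)` eigenfunction of the Schrödinger operator
`−∂²_{x_*} + V` with eigenvalue `−μ̂² = E₀ < −1/4000` (eqs. (ODEF), (pot); Props. 4.2–4.6),
the `H¹(ℝ)` condition being what forces `k₂ = c₁ = 0`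
(p. 6: "the solution can be shown to satisfy the admissible boundary conditions by the
condition that the solution lies in `H¹(ℝ)`"). The negativity of the spectrum comes from an
explicit test function: Prop. 4.5, `u_T = x(1 + |ω̂|² x³)(x − 1)^{1/n} e^{−4|ω̂|(x−1)}`,
`n = 100`, has `E(u_T) < 0` for `|ω̂| ∈ [3/10, 8/10]` ("the negativity is inferred via
complicated but purely algebraic calculations"). This file vendors, in the dimensionless
`x`-variable used by the source (so that no implicit inverse of the tortoise map is needed;
the source itself writes the `H¹` norm and `E(u_T)` in this variable, p. 20–21):

* `glP`, `glQ` (coefficients `p_ω̂`, `q_ω̂` of (HZX)), `glWeight` (`w`), `glPotential` (`V` of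
  (pot), as a function of `x`), `IsGLRadialMode ω̂ μ̂ 𝔥` (smooth solution of (HZX) on
  `(1,∞)`), `glH1Density`/`HasFiniteGLH1Norm` (the `H¹(ℝ)`-norm density
  `(|((x−1)/x) u'|² + |u|²) · x/(x−1)` of p. 20), `glEnergyDensity` (the density of `E` of
  (EFM) in the `x`-variable, p. 21), `glTestFunction` (`u_T`, `n = 100`).
* `GregoryLaflammeInstability` — **the barrier declaration** (named fact, D-0014; structured
  block in its docstring): Theorem 1.1 / Proposition 4.1 in the reduced form actually
  established in §4 — for `3/10 ≤ |ω̂| ≤ 8/10` there are `μ̂ > 1/(20√10)` and a smooth,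
  not identically vanishing solution `𝔥` of (HZX) on `(1, ∞)` such that `𝔥/w` has finite
  `H¹(ℝ)`-norm. Consequence `GregoryLaflammeInstability.exists_pos` (`μ̂ > 0`, proved).
* `GregoryLaflammeTestEnergyNegative` — Proposition 4.5 as a named fact (the dischargeable
  analytic core: an explicit real integral is negative).
* `blackRingSpinSq ν = (1+ν)³/(8ν)`, `blackRingArea`, `myersPerrySpinSq ν = 1/(1+ν²)` — the
  printed phase curves of Emparan–Reall (2008), eqs. of §5.1.1 and §4.1 (`d = 5`:
  `j² = 1/(1+ν²)`, `a_H² = 8ν²/(1+ν²)`), and `blackRing_nonuniqueness` — **proved**: for every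
  `27/32 < j² < 1` there are a thin ring parameter `ν₁ ∈ (0, 1/2)`, a fat ring parameter
  `ν₂ ∈ (1/2, 1)` and a Myers–Perry parameter `ν₃ > 0` with the same `j²` (intermediate value
  theorem on the printed curves; at the cusp `j² = 27/32` the two ring branches coincide).

Nothing about `D = 4` is asserted. The geometric content behind the named facts (that (HZX)
is the reduction of the linearised vacuum Einstein equation on `Sch₄ × ℝ` in spherical gauge,
that `H¹`-solutions give regular, decaying, non-gauge TT modes, that the black ring metric is a
regular asymptotically flat vacuum black hole with the stated `(j, a_H)`) is docstring-level
with precise cites; the prelude has `Spacetime d` for all `d` but no higher-dimensional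
asymptotics, horizons or linearised Einstein operator.

## References

* S. C. Collingbourne, *The Gregory–Laflamme instability of the Schwarzschild black string
  exterior*, J. Math. Phys. 62 (2021) 032502 = arXiv:2007.08441: §1.1 (pp. 3–4), Def. 1.1 and
  Thm. 1.1 (§1.3, pp. 4–5), §1.4–§1.7 (pp. 5–8), Props. 3.1–3.7 and eq. (HZ) (pp. 11–18),
  Prop. 4.1, §4.1 eqs. (HZX), (ODEF), (pot), Props. 4.2–4.5 (pp. 19–21), Prop. 4.6 (p. 22).
  Key `Collingbourne2021`.
* R. Gregory, R. Laflamme, *Black strings and p-branes are unstable*, Phys. Rev. Lett. 70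
  (1993) 2837 = arXiv:hep-th/9301052 (abstract). Key `GregoryLaflamme1993`.
* R. Emparan, H. S. Reall, *A rotating black ring solution in five dimensions*, Phys. Rev.
  Lett. 88 (2002) 101101; *Black holes in higher dimensions*, Living Rev. Relativ. 11 (2008)
  6 = arXiv:0801.3471, §4.1 (p. 11), §5.1.1 (p. 14), §8.1–§8.4 (pp. 30–31). Keys
  `EmparanReall2002`, `EmparanReall2008`; R. C. Myers, M. J. Perry, Ann. Phys. 172 (1986) 304
  (`MyersPerry1986`).
* L. Lehner, F. Pretorius, Phys. Rev. Lett. 105 (2010) 101102 = arXiv:1006.5960 (abstract);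
  P. Figueras, M. Kunesch, S. Tunyasuvunakool, Phys. Rev. Lett. 116 (2016) 071102 =
  arXiv:1512.04532 (abstract); P. Figueras, M. Kunesch, L. Lehner, S. Tunyasuvunakool, Phys.
  Rev. Lett. 118 (2017) 151103 = arXiv:1702.01755 (abstract). Keys `LehnerPretorius2010`,
  `FiguerasKuneschTunyasuvunakool2016`, `FiguerasEtAl2017`.
* G. Benomio, Anal. PDE 14 (2021) 2427–2496 = arXiv:1809.07795 (abstract); S. Hollands,
  S. Yazadjiev, Comm. Math. Phys. 283 (2008) 749. Keys `Benomio2021`, `HollandsYazadjiev2008`.* (Barrier audit, 2026-08-14 — delimitation of the technique class.) A. Ishibashi, H. Kodama,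
  *Stability of higher-dimensional Schwarzschild black holes*, Prog. Theor. Phys. 110 (2003)
  901–919 = arXiv:hep-th/0305185 (abstract); P.-K. Hung, J. Keller, M.-T. Wang, *Linear
  stability of higher dimensional Schwarzschild spacetimes: decay of master quantities*, Ann.
  PDE 6 (2020) 7 = arXiv:1809.05144 (abstract, Thms. 1–2, p. 4); V. Schlue, *Decay of linear
  waves on higher-dimensional Schwarzschild black holes*, Anal. PDE 6 (2013) 515–600 =
  arXiv:1012.5963 (abstract); R. Brito, V. Cardoso, P. Pani, *Massive spin-2 fields on black
  hole spacetimes*, Phys. Rev. D 88 (2013) 023514 = arXiv:1304.6725 (§2.3 p. 6, §3 p. 10);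
  E. Babichev, A. Fabbri, *Instability of black holes in massive gravity*, Class. Quantum
  Grav. 30 (2013) 152001 = arXiv:1304.5992 (abstract); G. W. Gibbons, D. Ida, T. Shiromizu,
  *Uniqueness and non-uniqueness of static vacuum black holes in higher dimensions*, Prog.
  Theor. Phys. Suppl. 148 (2002) 284–290 = arXiv:gr-qc/0203004 (p. 4). Keys
  `IshibashiKodama2003`, `HungKellerWang2020`, `Schlue2013`, `BritoCardosoPani2013`,
  `BabichevFabbri2013`, `GibbonsIdaShiromizu2002`.
* (Barrier audit, 2026-08-17, gen 1 — confirmation at page level; evasion (iii) sharpened,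
  evasion (viii) added.) S. Hollands, R. M. Wald, *Stability of black holes and black branes*,
  Comm. Math. Phys. 321 (2013) 629–680 = arXiv:1201.0463 (abstract; §1 p. 6; Prop. 6, §5
  p. 26; Prop. 7, §6 p. 30); K. Prabhu, R. M. Wald, *Black hole instabilities and exponential
  growth*, Comm. Math. Phys. 340 (2015) 253–290 = arXiv:1501.02522 (abstract); P. Figueras,
  K. Murata, H. S. Reall, *Black hole instabilities and local Penrose inequalities*, Class.
  Quantum Grav. 28 (2011) 225030 = arXiv:1107.5785 (abstract; §2 p. 7); S. Alexakis, *The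
  Penrose inequality on perturbations of the Schwarzschild exterior*, arXiv:1506.06400;
  G. Huisken, T. Ilmanen, J. Differential Geom. 59 (2001) 353–437; H. L. Bray, J. Differential
  Geom. 59 (2001) 177–267. Keys `HollandsWald2012`, `PrabhuWald2015`,
  `FiguerasMurataReall2011`, `Alexakis2015`, `HuiskenIlmanen2001`, `Bray2001`.
-/

noncomputable section

open MeasureTheory Set Filter Topology

namespace Literature.Barriers.FinalStateConjecture

/-! ### Collingbourne's reduced ODE problem (dimensionless variable `x = r/2M ∈ (1, ∞)`) -/

/-- The coefficient `p_ω̂(x) = 1/(x−1) − 5/x + 6/(x(ω̂²x³ + 1))` of the first-order term of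
the dimensionless radial mode ODE (HZX) (Collingbourne, arXiv:2007.08441, §4.1; obtained from
`P_ω` of eq. (HZ), §3.2, by `x = r/2M`, `ω̂ = 2Mω`). [cite: Collingbourne2021, §4.1 eq. (HZX)] -/
def glP (ω x : ℝ) : ℝ := 1 / (x - 1) - 5 / x + 6 / (x * (ω ^ 2 * x ^ 3 + 1))

/-- The coefficient `q_ω̂(x) = 3/(x²(x−1)) − ω̂²x/(x−1) − 3/(x²(x−1)(1+ω̂²x³))` of the
zeroth-order term of (HZX) (the full zeroth-order coefficient is `q_ω̂(x) − μ̂²x²/(x−1)²`).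
[cite: Collingbourne2021, §4.1 eq. (HZX)] -/
def glQ (ω x : ℝ) : ℝ :=
  3 / (x ^ 2 * (x - 1)) - ω ^ 2 * x / (x - 1) - 3 / (x ^ 2 * (x - 1) * (1 + ω ^ 2 * x ^ 3))

/-- The weight `w(x) = (1 + ω̂²x³)/x` of the Schrödinger reformulation `𝔥 = w 𝔥̃`
(Collingbourne, §4.1, the displayed solution of the weight ODE). [cite: Collingbourne2021, §4.1] -/
def glWeight (ω x : ℝ) : ℝ := (1 + ω ^ 2 * x ^ 3) / x

/-- The Gregory–Laflamme potential
`V = ω̂²(x−1)/x + (6x−11)(x−1)/x⁴ + 18(x−1)²/(x⁴(1+ω̂²x³)²) − 6(4x−5)(x−1)/(x⁴(1+ω̂²x³))`,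
`x ∈ (1, ∞)`, of the Schrödinger form `−∂²_{x_*}𝔥̃ + V 𝔥̃ = −μ̂² 𝔥̃` of (HZX) in the tortoise
variable `x_* = x + log|x − 1|` (Collingbourne, §4.1, eqs. (ODEF), (pot): "a potential which
decays to zero at the future event horizon and tends to the constant `ω̂²` at spatial
infinity"); here as a function of `x` (the source writes `V(x_*)` "where `x` is understood as
an implicit function of `x_*`"). [cite: Collingbourne2021, §4.1 eq. (pot)] -/
def glPotential (ω x : ℝ) : ℝ :=
  ω ^ 2 * (x - 1) / x + (6 * x - 11) * (x - 1) / x ^ 4 +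
    18 * (x - 1) ^ 2 / (x ^ 4 * (1 + ω ^ 2 * x ^ 3) ^ 2) -
    6 * (4 * x - 5) * (x - 1) / (x ^ 4 * (1 + ω ^ 2 * x ^ 3))

/-- `𝔥` is a **smooth solution of the radial mode ODE (HZX)** with parameters `(ω̂, μ̂)` on the
exterior `x ∈ (1, ∞)`:
`𝔥'' + p_ω̂ 𝔥' + (q_ω̂ − μ̂² x²/(x−1)²) 𝔥 = 0` (Collingbourne, §4.1 eq. (HZX); by Prop. 3.2
such an `𝔥 = H_z`, for `ω̂ ≠ 0 ≠ μ̂`, generates a mode solution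
`h = e^{μt + iωz} H(r)` in spherical gauge of the linearised vacuum Einstein equation on the
exterior of `Sch₄ × ℝ`, and on `Sch₄ × 𝕊¹_R` when `ωR ∈ ℤ`). Smoothness is `C^∞` on the open
half-line (Prop. 4.1: "a `C^∞((2M,∞))` solution"; exponent `((⊤ : ℕ∞) : WithTop ℕ∞) = ∞`, not `ω`);
`deriv` is the ordinary derivative, which
on the open set `(1, ∞)` agrees with the derivative of the restriction.
[cite: Collingbourne2021, Prop. 3.2 and §4.1 eq. (HZX)] -/
def IsGLRadialMode (ω μ : ℝ) (𝔥 : ℝ → ℝ) : Prop :=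
  ContDiffOn ℝ ((⊤ : ℕ∞) : WithTop ℕ∞) 𝔥 (Ioi 1) ∧
    ∀ x ∈ Ioi (1 : ℝ), deriv (deriv 𝔥) x + glP ω x * deriv 𝔥 x +
      (glQ ω x - μ ^ 2 * x ^ 2 / (x - 1) ^ 2) * 𝔥 x = 0

/-- The **`H¹(ℝ)`-norm density in the `x`-variable**: for a function `u` of the tortoise
variable `x_* ∈ ℝ`, `‖u‖²_{H¹(ℝ)} = ∫₁^∞ |((x−1)/x) du/dx|² (x/(x−1)) dx + ∫₁^∞ |u|² (x/(x−1)) dx`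
"where on the right-hand side the change of variables from `x_* ∈ ℝ` to `x ∈ (1,∞)` has been
made" (Collingbourne, §4.3, the display after eq. (fk), p. 20; `dx_*/dx = x/(x−1)`).
[cite: Collingbourne2021, §4.3 p. 20] -/
def glH1Density (u : ℝ → ℝ) (x : ℝ) : ℝ :=
  (((x - 1) / x * deriv u x) ^ 2 + u x ^ 2) * (x / (x - 1))

/-- `u` (a function of `x ∈ (1,∞)`) **has finite `H¹(ℝ)`-norm as a function of the tortoise
variable**: the density `glH1Density u` is integrable on `(1, ∞)`. For smooth `u` this is
membership in `H¹(ℝ)`, the condition under which Collingbourne's eigenfunction satisfies the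
admissible boundary conditions `k̃₂ = 0` (regularity at `𝓗⁺_A` after adding a pure gauge
solution) and `c̃₁ = 0` (exponential decay towards `i⁰_A`) (p. 6 and Prop. 4.2).
[cite: Collingbourne2021, §1.4 p. 6 and Prop. 4.2] -/
def HasFiniteGLH1Norm (u : ℝ → ℝ) : Prop := IntegrableOn (glH1Density u) (Ioi 1)

/-- The **energy density in the `x`-variable** of the functional
`E(u) = ⟨∇_{x_*}u, ∇_{x_*}u⟩_{L²(ℝ)} + ⟨V u, u⟩_{L²(ℝ)}` (Collingbourne, eq. (EFM), Cor. 4.4):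
`E(u) = ∫₁^∞ ( |((x−1)/x) du/dx|² + V u² ) (x/(x−1)) dx` (§4.3, the display defining `E(u_T)`
with the change of variables from `x_*` to `x`, p. 21). [cite: Collingbourne2021, §4.3 p. 21 and Cor. 4.4] -/
def glEnergyDensity (ω : ℝ) (u : ℝ → ℝ) (x : ℝ) : ℝ :=
  (((x - 1) / x * deriv u x) ^ 2 + glPotential ω x * u x ^ 2) * (x / (x - 1))

/-- **Collingbourne's test function** `u_T(x_*) := x(1 + |ω̂|²x³)(x − 1)^{1/n} e^{−4|ω̂|(x−1)}`
with `n = 100`, as a function of `x ∈ (1, ∞)` (Prop. 4.5). [cite: Collingbourne2021, Prop. 4.5] -/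
def glTestFunction (ω x : ℝ) : ℝ :=
  x * (1 + |ω| ^ 2 * x ^ 3) * (x - 1) ^ ((1 : ℝ) / 100) * Real.exp (-4 * |ω| * (x - 1))

/-- **Proposition 4.5 of Collingbourne (the analytic core of the Gregory–Laflamme
instability), as a named fact (D-0014: nothing asserted).** "Then `u_T ∈ H¹(ℝ)` and, for
`n = 100` and `|ω̂| ∈ [3/10, 8/10]`, `E₀ ≤ E(u_T) < 0`" — rendered: for `3/10 ≤ |ω̂| ≤ 8/10`
the test function has finite `H¹(ℝ)`-norm, its energy density is integrable on `(1,∞)` and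
`E(u_T) = ∫₁^∞ (|((x−1)/x) u_T'|² + V u_T²)(x/(x−1)) dx < 0` (the printed `u_T ∈ H¹(ℝ)`
holds for every `ω̂ ≠ 0` and `n ≥ 1`; it is recorded here only on the band). The source
evaluates the integrals through `I_k = ∫₀^∞ (t+1)^{k−1} t^{2/n−1} e^{−8|ω̂|t} dt = Γ(2/n) U(2/n, k + 2/n; 8|ω̂|)`
and the recurrences of the confluent hypergeometric function `U`, reducing `E(u_T)/‖u_T‖²_{L²}`
to an explicit rational function of `|ω̂|` ("the negativity is inferred via complicated but
purely algebraic calculations", §4.3). Dischargeable in principle from Mathlib's Gamma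
integrals; not attempted here. [cite: Collingbourne2021, Prop. 4.5 and §4.3 pp. 20–22] -/
def GregoryLaflammeTestEnergyNegative : Prop :=
  ∀ ω : ℝ, 3 / 10 ≤ |ω| → |ω| ≤ 8 / 10 →
    HasFiniteGLH1Norm (glTestFunction ω) ∧
      IntegrableOn (glEnergyDensity ω (glTestFunction ω)) (Ioi 1) ∧
        ∫ x in Ioi 1, glEnergyDensity ω (glTestFunction ω) x < 0

/-- **Barrier: in five dimensions the Schwarzschild black string is linearly unstable — the
Gregory–Laflamme instability, Collingbourne's theorem in its reduced (ODE) form** (named fact,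
D-0014: `def … : Prop`, nothing asserted). As printed (J. Math. Phys. 62 (2021) 032502,
Thm. 1.1 with Props. 4.1, 4.6 and §4): for every frequency `3/10 ≤ |ω̂| ≤ 8/10` (`ω̂ = 2Mω`, i.e.
`|ω| ∈ [3/(20M), 8/(20M)]`) there exist a growth rate `μ̂ = 2Mμ > 1/(20√10)` (i.e.
`μ > 1/(40√10 M)`; Prop. 4.6: "`μ̂ > 1/(20√10) > 0`") and a smooth, not identically vanishing
solution `𝔥` of the radial mode ODE
(HZX) on `(1, ∞)` (`IsGLRadialMode`) such that `𝔥̃ = 𝔥/w`, `w = (1+ω̂²x³)/x`, has finite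
`H¹(ℝ)`-norm in the tortoise variable (`HasFiniteGLH1Norm`; §4: "there exists a weak solution
`u ∈ H¹(ℝ)` with `‖u‖_{H¹(ℝ)} = 1` such that `μ > 0` [...] the solution `u` is indeed smooth
for `r ∈ (2M,∞)` and satisfies the conditions of proposition 3.7, i.e., `k₂ = 0` and
`c₁ = 0`"). By Props. 3.2, 3.3, 3.4, 3.6, 3.7 this `𝔥` generates the exponentially growing
mode solution `h = e^{μt+iωz}H(r)` of the linearised vacuum Einstein equation on the exterior
of `Sch₄ × ℝ` (and of `Sch₄ × 𝕊¹_R`, `R > 4M`, with finite energy), regular at `𝓗⁺_A`,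
exponentially decaying at `i⁰_A`, not pure gauge, in harmonic/transverse-traceless gauge —
Theorem 1.1: "the exterior `𝓔_A` of the Schwarzschild black string `Sch₄ × ℝ` or `Sch₄ × 𝕊¹_R`
for `R > 4M` is linearly unstable as a solution of the vacuum Einstein equation". The companion
non-uniqueness fact (Emparan–Reall) is recorded in the module docstring and, at the level of
the printed phase curves, proved in `blackRing_nonuniqueness`.

The technique class stopped ("dimension-blind", meaning FLAT-FACTOR-BLIND methods) consists of
arguments towards the final state conjecture (the `(M, J)`-classification of the stationary end
states and the asymptotic stability of the Schwarzschild/Kerr exterior) whose steps would apply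
verbatim after taking the Ricci-flat product of the `3+1` spacetime with a flat factor `𝕊¹_R`
(`R > 4M`) or `ℝ`: "If one has the `n`-dimensional Schwarzschild black hole spacetime and takes
its Cartesian product with `F_p` then one realises the `(n+p)`-dimensional Schwarzschild black
brane [...] a product manifold made from Ricci-flat manifolds, which is again Ricci-flat and
hence satisfies the vacuum Einstein equation", with the same Penrose diagram ("the above Penrose
diagram can be reinterpreted as the Penrose diagram for the Schwarzschild black brane") and
arising "as the maximal Cauchy development of suitably extended Schwarzschild initial data"
(Collingbourne, §1.1, pp. 3–4). Read on the `Sch₄` factor, the unstable mode is spherically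
symmetric — "One makes the additional assumption that this mode solution preserves the spherical
symmetry of `Sch₄`" (§3, p. 11; the ansatz (GP) has only `(t, r, z)`-dependence) — with
`z`-momentum `ω ≠ 0`, i.e. after Kaluza–Klein reduction in `z` it is the `ℓ = 0` (monopole)
perturbation of Schwarzschild by a massive spin-2 field of mass `m = |ω|`, `Mm ∈ [3/20, 2/5]`:
"the linearized equations [of a massive spin-2 field on Schwarzschild] are equivalent to those
describing four-dimensional perturbations of a five-dimensional black string after a
Kaluza-Klein reduction of the extra dimension. Therefore, the system is affected by
Gregory-Laflamme instability [...] that manifests itself in the spherically symmetric, monopole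
mode", "a low-mass instability which disappears for `Mμ ≥ 0.43`" (Brito–Cardoso–Pani, §3,
p. 10; likewise Babichev–Fabbri, abstract); its threshold corresponds to the Gross–Perry–Yaffe
negative mode of the Euclidean Schwarzschild Lichnerowicz operator ("a direct relation between the
'negative mode' of the Euclidean Schwarzschild instanton solution [...] and the threshold of the
Gregory–Laflamme instability", Collingbourne §1.2, p. 4, on Reall 2001). So, for the STABILITY
pillar, the class consists exactly of the linear-stability arguments for the Schwarzschild
exterior that are blind to a Fierz–Pauli mass term of this size AND include the `ℓ = 0` sector
(`graviton-mass-blind`, `monopole-sector-inclusive`); for the UNIQUENESS pillar, of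
`(M, J)`-classifications of ROTATING stationary black holes by arguments blind to the horizon
topology. It does NOT contain the methods that are merely uniform in the dimension `D` for
ASYMPTOTICALLY FLAT black holes (the Schwarzschild–Tangherlini hole `Sch₅` is mode-stable and
its master quantities are uniformly bounded in every `D`, with decay for `D ≤ 6`:
Ishibashi–Kodama 2003; Hung–Keller–Wang 2020, Thm. 2; Schlue 2013), nor any `3+1` argument that
first disposes of the multipoles `ℓ = 0, 1` (linearised Kerr plus pure gauge) and treats `ℓ ≥ 2`
through gauge-invariant quantities — see `evasions_known` (v)–(viii) and `scope_caveats` (f), (g),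
(i) (barrier audits: 2026-08-14 — technique class NARROWED, formal fact unchanged; 2026-08-17,
gen 1 — CONFIRMED at page level, evasion (iii) sharpened, evasion (viii) added). The printed
dividing line for energy/positivity methods is Hollands–Wald's: the stability criterion is
positivity of the canonical energy `𝓔` on perturbations with vanishing linearised ADM
quantities, and "this explains why the Schwarzschild black hole can be dynamically stable despite
the fact that it is thermodynamically unstable: The thermodynamically unstable perturbations of
Schwarzschild have a nonvanishing linearized ADM mass and thus do not 'count' [...]. However, the
situation is very different for a family of black branes [...] one can find a sufficiently long
wavelength perturbation of the black brane for which `𝓔 < 0` but the linearized ADM mass,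
momentum, and angular momentum vanish" (§1, p. 6) — on `Sch₄` the monopole sector with `δM = 0`
is pure gauge (Birkhoff), on the string it carries the `z`-modulated change of mass (Prop. 6); an
energy/positivity argument that uses neither this rigidity of the `ℓ = 0`, `δM = 0` sector nor any
other input failing on `Sch₄ × 𝕊¹_R` is flat-factor-blind and obstructed, one that uses it is not.
Formally the class
is delimited by the two named facts of this file: any flat-factor-blind argument would apply
verbatim to `Sch₄ × 𝕊¹_R` (contradicting `GregoryLaflammeInstability`) and any
horizon-topology-blind `(M, J)`-classification to the `D = 5` stationary solutions (contradicting
the three-solutions statement `blackRing_nonuniqueness` read through Emparan–Reall, §5.1.1).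
[cite: Collingbourne2021, §1.1 pp. 3–4, §1.2 p. 4, §3 p. 11] [cite: BritoCardosoPani2013, §3 p. 10]
[cite: BabichevFabbri2013, abstract] [cite: EmparanReall2008, §5.1.1] [cite: HollandsWald2012, §1 p. 6]

BARRIER (D-0021; every clause is a quotation or close paraphrase of the cited locus):
* technique_class: dimension-blind, flat-factor-blind, Ricci-flat-product, flat-factor, Kaluza-Klein-reduction-blind, graviton-mass-blind, massive-spin-2-robust, monopole-sector-inclusive, Lichnerowicz-negative-mode-blind, horizon-topology-blind, rotating-mass-angular-momentum-classification
* blocks: the dimension-independent strengthening of the final state conjecture and each of its two pillars in `D = 5`: (i) uniqueness — "In four dimensions, the black hole uniqueness theorem states that there is at most one stationary, asymptotically flat, vacuum black hole solution with given mass and angular momentum: the Kerr black hole. The co-existence of Myers-Perry black holes and black rings shows explicitly that black hole uniqueness is violated in five dimensions" [cite: EmparanReall2008, §8.1 p. 30]; "in the range `√(27/32) ≤ j < 1` there exist three different solutions (thin and fat black rings, and MP black hole) with the same value of `j`" [cite: EmparanReall2008, §5.1.1 p. 14] [cite: EmparanReall2002] [cite: MyersPerry1986]; "This 'final state conjecture'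 cannot generalize immediately" [cite: Collingbourne2021, §1.7.2 p. 8]; (ii) stability — "the exterior `𝓔_A` of the Schwarzschild black string `Sch₄ × ℝ` or `Sch₄ × 𝕊¹_R` for `R > 4M` is linearly unstable as a solution of the vacuum Einstein equation, and the instability can be realised as a mode instability in harmonic/transverse-traceless gauge which is not pure gauge" [cite: Collingbourne2021, Thm. 1.1]; "While stationary black holes in 4 spacetime dimensions (4D) are stable to perturbations, higher dimensional analogues are not" [cite: LehnerPretorius2010, Introduction]; hence no flat-factor-blind argument — equivalently, on the `Sch₄` factor, no linear-stability argument that is blind to a spin-2 mass `Mm ∈ [3/20, 2/5]` and includes the monopole sector ("the system is affected by Gregory-Laflamme instability [...] that manifests itself in the spherically symmetric, monopole mode" [cite: BritoCardosoPani2013, §3 p. 10]) — establishes the linear stability of the Schwarzschild exterior (the `a = 0` case of `Literature.Barriers.FinalStateConjecture.KerrStabilityHoldsBelow`), and no horizon-topology-blind `(M, J)`-classification identifies the rotating final state in `Literature.Geometry.Lorentzian.Development.SettlesToKerrFamily`.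
* because: long-wavelength instability along the flat direction — "there are unstable modes for a range of time frequency and wavelength in the extra `10 − D` dimensions" [cite: GregoryLaflamme1993, abstract]; in Collingbourne's proof, "the linearised vacuum Einstein equation reduces to an ODE problem for a single function [...] a suitable rescaling and change of variables is applied which casts the ODE into a Schrödinger eigenvalue equation to which an energy functional is assigned. It is then shown by direct variational methods that the lowest eigenfunction gives rise to an exponentially growing mode solution which has admissible behavior at the future event horizon and spacelike infinity" [cite: Collingbourne2021, abstract, §1.4, Props. 4.3–4.5]; thermodynamic/entropic origin: "for a given mass per unit length and periodic spacing above a critical wavelength `λ_c`, a sequence of hyperspherical black holes has higher entropy than the corresponding black string" [cite: LehnerPretorius2010, Introduction], and via canonical energy "the Schwarzschild black string fails to be asymptotically stable" already from the `𝓔 < 0` change-of-mass perturbation of Schwarzschild [cite: Collingbourne2021, §1.5] — in general "for any black brane corresponding to a thermodynamically unstable black hole, sufficiently long wavelength perturbations can be found with `𝓔 < 0` and vanishing linearized ADM quantities. Thus, all black branes corresponding to thermodynmically [sic] unstable black holes are dynamically unstable, as conjectured by Gubser and Mitra" [cite: HollandsWald2012, abstract and Prop. 6 p. 26], whereas for the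 hole itself "the thermodynamically unstable perturbations of Schwarzschild have a nonvanishing linearized ADM mass and thus do not 'count' for the analysis of dynamical stability" [cite: HollandsWald2012, §1 p. 6]; and "if a perturbation of the form `£_t δg` [...] has negative canonical energy, then that perturbation must, in fact, grow exponentially in time" [cite: PrabhuWald2015, abstract]; non-uniqueness: black rings have "horizon topology `S¹ × S²` in asymptotically flat spacetime. The `S¹` describes a contractible circle, not stabilized by topology but by the centrifugal force provided by rotation" [cite: EmparanReall2008, §5.1.1 p. 14].
* evasions_known: (i) use `D = 4` structure explicitly: "In higher dimensions, many results from 4D general relativity no longer hold. As shown by Hawking, in 4D the cross-sections of the event horizon of an asymptotically flat stationary black hole spacetime must be topologically `𝕊²`" [cite: Collingbourne2021, §1.7.2 p. 8]; "Logically, the first step in the proof of the `d=4` black hole uniqueness theorem is Hawking's black hole topology theorem" [cite: EmparanReall2008, §8.2 p. 30]; for perturbations, "For Kerr, the study of gravitational perturbations is analytically tractable because of a seemingly-miraculous decoupling [...] allowing it to be reduced to a single scalar equation. An analogous decoupling has not been achieved for Myers-Perry black holes" [cite: EmparanReall2008, §4.1 p. 13]; (ii) restore uniqueness in `D = 5`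 by extra data: "stationary, non-extremal, asymptotically flat, vacuum black hole solutions with two rotational symmetries are uniquely characterized by their mass, angular momenta, and rod structure" [cite: EmparanReall2008, §8.4 p. 31] [cite: HollandsYazadjiev2008]; (iii) compactify below the critical wavelength: "These perturbations can be stabililized if the extra dimensions are compactified to a scale smaller than the minimum wavelength for which instability occurs" [cite: GregoryLaflamme1993, abstract]. Quantitatively (audit 2026-08-17): Theorem 1.1 is printed for `R > 4M` — "Suppose `R > 4M`, then one can choose `ω` such that there exists an integer `n ∈ [3R/20M, 8R/20M]`" [cite: Collingbourne2021, Thm. 1.1 p. 5], the circle being `z ∈ ℝ/2πRℤ` [cite: Collingbourne2021, §1.1 p. 4] — but `R > 4M` only makes that window longer than `1`: `n = 1` already lies in it for `5M/2 ≤ R ≤ 20M/3`, and the windows `[5nM/2, 20nM/3]`, `n ≥ 1`, overlap, so the printed construction gives the finite-energy unstable mode on `Sch₄ × 𝕊¹_R` for every `R ≥ 5M/2`; numerically the uniform `D = 5` string (`x ∼ x + 2πL`, `r₊ = 2M`) is unstable exactly below "the critical value below which the GL instability exists: `r₊/L = 0.8762`" [cite: FiguerasMurataReall2011, §2 p. 7],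 i.e. for `R > 2.283M`; and for all SUFFICIENTLY LARGE circles, in every dimension and for every thermodynamically unstable family, the instability (a perturbation with `𝓔 < 0` and vanishing linearised ADM and Kaluza–Klein charges, hence exponential growth) is a theorem independent of the explicit band [cite: HollandsWald2012, Prop. 6 p. 26] [cite: PrabhuWald2015, abstract] — so the rigorously unobstructed compactifications are `R < 5M/2`, the numerically stable ones `R < 2.28M`; (iv) reformulate: "The final state conjecture may need to be modified to include the property of stability" [cite: Collingbourne2021, §1.7.2 p. 8]; (v) use the asymptotic flatness of the FULL spacetime (compact horizon sections, `SO(D−1)` symmetry) — methods uniform in `D` are not obstructed: for the `D`-dimensional Schwarzschild(–Tangherlini) hole "for each mode of the perturbations, the spatial derivative part of the master equation is a positive, self-adjoint operator in the `L²`-Hilbert space, and hence [...] the master equation for each type of perturbation has no normalisable negative modes that would correspond to unstable solutions" [cite: IshibashiKodama2003, abstract]; "we strengthen the mode stability result of Kodama-Ishibashi to a uniform boundedness estimate in all dimensions; further, we prove decay estimates in the case of six or fewer spacetime dimensions" (gauge-invariant master quantities, `Ě(Σ_τ) ≤ C(n,M) I(Σ₀)/τ²`) [cite: HungKellerWang2020,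 abstract and Thm. 2]; for `□_g φ = 0` "the associated energy flux [...] decays, `E[φ](Σ_τ) ≤ CD/τ²`, where `C` is a constant only depending on `n` and `m`" for every spatial dimension `n ≥ 3` [cite: Schlue2013, abstract]; (vi) work modulo the low multipoles: "The Gregory-Laflamme instability only affects spherically-symmetric (`l = 0`) modes" and "in the massless limit the monopole reduces to the scalar-field wave equation with `l = 0`" [cite: BritoCardosoPani2013, §3 p. 10]; a `3+1` argument that first writes the `ℓ < 2` part as linearised Kerr plus pure gauge ("`δg^{ℓ<2} = π_X + cK + Σ d_m K_m`" [cite: HungKellerWang2020, Thm. 1]) and controls `ℓ ≥ 2` through gauge-invariant (Regge–Wheeler/Zerilli/Teukolsky-type) quantities never meets the Gregory–Laflamme mode; (vii) classify STATIC end states: "The only `n`-dimensional asymptotically flat static vacuum black hole with non-degenerate regular event horizon is the Schwarzschild-Tangherlini family" [cite: GibbonsIdaShiromizu2002, p. 4]; "the classification problem for static black holes has been solved" [cite: EmparanReall2008, §8.3 p. 30] — only the ROTATING `(M, J)`-classification is obstructed by the black ring; (viii) (audit 2026-08-17) area–mass (Penrose-inequality) variational arguments are flat-factor-SENSITIVE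 through the inequality itself and are not obstructed: "for black holes, the satisfaction of the local Penrose inequality is equivalent to the positivity of canonical energy for perturbations with `δM = δJ_A = δP_i = 0` and hence, by our previous arguments, is equivalent to dynamical stability" [cite: HollandsWald2012, §6 Prop. 7 p. 30]; at the `3+1` Schwarzschild slice the inequality HOLDS — for time-symmetric data it is the Riemannian Penrose inequality `A ≤ 16πM²`, with equality only for the Schwarzschild slice, proved by the Geroch monotonicity of the Hawking mass along (weak) inverse mean curvature flow, a Gauss–Bonnet argument on the `2`-dimensional level sets [cite: HuiskenIlmanen2001], resp. by a conformal flow and the positive mass theorem [cite: Bray2001], and near a null hypersurface of a perturbed Schwarzschild exterior "the area of `𝒮₀` yields a lower bound for the Bondi energy [...] Our argument is perturbative, and rests on suitably deforming the initial null hypersurface [...] to one for which the natural 'luminosity' foliation originally introduced by Hawking yields a monotonically increasing Hawking mass" [cite: Alexakis2015, abstract] — whereas for the compactified string "we construct initial data which violates the inequality almost exactly where the Gregory-Laflamme instability appears" (time-symmetric conformally rescaled data, violation for `r₊/L < 0.8745` against the GL threshold `0.8762`) [cite: FiguerasMurataReall2011, abstract and §2 pp. 6–7], as it must by Hollands–Wald's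 Props. 6–7; so an argument deriving the canonical-energy (mode) stability of the `3+1` end state, or its rigidity, from a sharp global area–mass(–angular-momentum) inequality whose equality case is the stationary family does not transplant to `Sch₄ × 𝕊¹_R`.
* scope_caveats: (a) the black string is "not asymptotically flat but [...] 'asymptotically Kaluza–Klein'" [cite: Collingbourne2021, §1.1 p. 3]; the theorem is a LINEAR mode instability in `D = 5` (the extension to higher `D` "readily extends" but is not printed as a theorem [cite: Collingbourne2021, §1.6]), with the explicit ranges `|ω| ∈ [3/(20M), 8/(20M)]`, `μ > 1/(40√10 M)`; no nonlinear statement is printed; (b) the end state — horizon pinch-off in finite asymptotic time and hence a violation of weak cosmic censorship "without 'unnatural' initial conditions or fine-tuning" — is NUMERICAL evidence: "The simulation results imply that the string segments will reach zero radius in finite asymptotic time, whence the classical space-time terminates in a naked singularity" [cite: LehnerPretorius2010, abstract]; likewise for asymptotically flat `D = 5` thin black rings ("We produce the first concrete evidence that violation of the weak cosmic censorship conjecture can occur in asymptotically flat spaces of five dimensions by numerically evolving perturbed black rings") [cite: FiguerasKuneschTunyasuvunakool2016, abstract] and `D = 6` ultraspinning Myers–Perry ("resulting in the formation of a naked singularity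 in finite asymptotic time and hence a violation of the weak cosmic censorship conjecture in asymptotically flat higher-dimensional spaces") [cite: FiguerasEtAl2017, abstract]; the only rigorous dynamical statement for black RINGS is a logarithmic lower bound on the uniform energy decay rate of linear scalar waves from stable trapping [cite: Benomio2021, abstract] ("in 2018 [Benomio] produced the first mathematically rigorous result on the stability problem for the black ring spacetime" [cite: Collingbourne2021, §1.7.3 p. 8]); (c) of the non-uniqueness only the printed phase-curve arithmetic is formalised (`blackRing_nonuniqueness`); that each parameter value is a regular asymptotically flat vacuum black hole with these `(j, a_H)` is the cited fact [cite: EmparanReall2008, §4.1, §5.1.1], and at `j = √(27/32)` exactly the thin and fat branches coincide (the cusp `ν = 1/2`), so "three different solutions" holds on the open range; (d) nothing here is a theorem about `D = 4`, and no source asserts that any specific `3+1` technique fails — the barrier constrains only arguments that do not use the dimension; (e) the formal declarations are in the dimensionless `x`-variable; the reduction from Theorem 1.1 to (HZX) + `H¹` (Props. 3.1–3.7, 4.2) is docstring-level; (f) (barrier audit 2026-08-14, NARROWED) rev. 1 also tagged `dimension-independent`, `all-dimensions`, `arbitrary-dimension`, `generic-Einstein-vacuum-structure`: these over-covered — the printed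 theorem concerns the asymptotically Kaluza–Klein string `Sch₄ × 𝕊¹_R`/`Sch₄ × ℝ`, while the asymptotically flat hole `Sch₅` (indeed `Sch_D`, every `D`) is mode-stable [cite: IshibashiKodama2003, abstract] with uniformly bounded (all `D`) and decaying (`D ≤ 6`) master quantities [cite: HungKellerWang2020, Thm. 2], so a method is obstructed only if it is ALSO blind to the flat factor (evasions (v)–(vi)); (g) the unstable family is the single `ℓ = 0` mode with `M|ω| ∈ [3/20, 2/5]` (numerically the instability exists for `0 < Mm < 0.43`, and for the `ℓ ≥ 1` Kaluza–Klein sectors "we expect the rest of the sector to be stable. We confirm this result" [cite: BritoCardosoPani2013, §3 p. 10]); in the massless `3+1` problem the `ℓ < 2` sector is linearised Kerr plus pure gauge [cite: HungKellerWang2020, Thm. 1], so there is no monopole to destabilise; and the Lehner–Pretorius sentence quoted in `blocks` (ii) refers to extended/higher-dimensional objects (strings, and numerically thin rings and ultraspinning Myers–Perry, caveat (b)), not to `Sch_D`; (h) the quantitative core is proved in the tree: `GregoryLaflammeTestEnergyNegative_holds` (`…Proofs.lean`, the sign of `E(u_T)`), the bound `E(u_T) < −(1/4000)‖u_T‖²_{L²}`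 of p. 22 (`GregoryLaflammeTestEnergyBound`, `…Schrodinger.lean`; certified in `…Proofs.lean` by a Bernstein-form certificate — the printed Sturm argument gives the sign only, and the constant is tight at `|ω̂| = 3/10`, where `E(u_T)/‖u_T‖²_{L²} = −2.56·10⁻⁴`) and the reduction `GregoryLaflammeInstability_of` (`…Schrodinger.lean`), leaving `GregoryLaflammeInstability` resting on the variational named fact `GregoryLaflammeNegativeEigenfunction` (Prop. 4.3, Cor. 4.4, Thm. 8.3) alone [cite: Collingbourne2021, §4.3 p. 22]; (i) (barrier audit 2026-08-17, gen 1: CONFIRMED) every quoted locus re-read at page level (Collingbourne Thm. 1.1 p. 5 and §1.2 p. 4; Brito–Cardoso–Pani §3 p. 10; Emparan–Reall §5.1.1 p. 14, §8.1–§8.3 p. 30, §8.4 p. 31; Hung–Keller–Wang abstract and Thms. 1–2 p. 4; Ishibashi–Kodama abstract; Gibbons–Ida–Shiromizu p. 4; Lehner–Pretorius p. 2; Hollands–Wald pp. 6, 26, 30); the technique class of the 2026-08-14 audit stands; the remaining named fact `GregoryLaflammeNegativeEigenfunction` is textbook variational spectral theory (potential bounded and continuous, `V → 0` at the horizon end and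 `V → ω̂²` at the far end of the tortoise line, so a Rayleigh quotient `< E' < 0` lies below the essential spectrum `[0, ∞)`), hence no refutation of the formal fact is available; the theorem covers the non-rotating string only (`a = 0`; nothing is printed for `Kerr × 𝕊¹_R`), and under-claims rather than over-claims on the uniqueness side: "the assumption of staticity is stronger than requiring vanishing total angular momentum. The existence of black Saturns [...] shows that there exists an infinite number of solutions (with disconnected event horizons) characterized by a given mass and vanishing angular momentum" [cite: EmparanReall2008, §8.3 p. 30], so in `D = 5` a horizon-connectedness-blind `(M, J = 0)`-classification fails as well, while with two rotational symmetries "the Myers-Perry solution is the unique stationary, non-extremal, asymptotically flat, vacuum black hole solution of spherical topology" [cite: EmparanReall2008, §8.4 p. 31].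
* status: established — linear instability [cite: Collingbourne2021, Thm. 1.1] (numerically since [cite: GregoryLaflamme1993]); non-uniqueness [cite: EmparanReall2002] [cite: EmparanReall2008, §5.1.1, §8.1]; the cosmic-censorship-violating end states are numerical, not theorems [cite: LehnerPretorius2010] [cite: FiguerasKuneschTunyasuvunakool2016] [cite: FiguerasEtAl2017]; the `3+1` reading of the unstable mode as the massive-spin-2 monopole is established at the level of the linearised equations [cite: BritoCardosoPani2013, §2.3, §3] [cite: BabichevFabbri2013, abstract]; audit 2026-08-14: technique class NARROWED to flat-factor-blind ≡ graviton-mass-blind-and-monopole-inclusive (stability) and rotating-classification (uniqueness), formal fact unchanged; audit 2026-08-17 (gen 1): CONFIRMED at page level; instability of `Sch_D × 𝕋^p` for all sufficiently large tori also by canonical energy [cite: HollandsWald2012, Prop. 6] [cite: PrabhuWald2015, abstract]; evasions (iii) sharpened (`R ≥ 5M/2` rigorous, `R > 2.28M` numerical [cite: FiguerasMurataReall2011, §2 p. 7]) and (viii) added. -/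
def GregoryLaflammeInstability : Prop :=
  ∀ ω : ℝ, 3 / 10 ≤ |ω| → |ω| ≤ 8 / 10 →
    ∃ μ : ℝ, 1 / (20 * Real.sqrt 10) < μ ∧
      ∃ 𝔥 : ℝ → ℝ, IsGLRadialMode ω μ 𝔥 ∧ (∃ x ∈ Ioi (1 : ℝ), 𝔥 x ≠ 0) ∧
        HasFiniteGLH1Norm (fun x ↦ 𝔥 x / glWeight ω x)

/-- Consequence of the named fact: in the Gregory–Laflamme band the growth rate is positive,
`μ̂ > 1/(20√10) > 0` — an exponentially GROWING mode (Collingbourne, Thm. 1.1: "`μ > 0`").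
[cite: Collingbourne2021, Thm. 1.1] -/
theorem GregoryLaflammeInstability.exists_pos (h : GregoryLaflammeInstability) {ω : ℝ}
    (h1 : 3 / 10 ≤ |ω|) (h2 : |ω| ≤ 8 / 10) :
    ∃ μ : ℝ, 0 < μ ∧ ∃ 𝔥 : ℝ → ℝ, IsGLRadialMode ω μ 𝔥 ∧ (∃ x ∈ Ioi (1 : ℝ), 𝔥 x ≠ 0) := by
  obtain ⟨μ, hμ, 𝔥, hmode, hne, -⟩ := h ω h1 h2
  exact ⟨μ, lt_trans (by positivity) hμ, 𝔥, hmode, hne⟩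

/-- The band of Theorem 1.1 is nonempty and excludes `ω̂ = 0` (so that Props. 3.2–3.3 apply:
"if `ω ≠ 0`, then mode solutions in spherical gauge are not pure gauge"). [cite: Collingbourne2021, Prop. 3.3] -/
lemma ne_zero_of_mem_glBand {ω : ℝ} (h1 : 3 / 10 ≤ |ω|) : ω ≠ 0 := by
  rintro rfl
  norm_num at h1

/-! ### Emparan–Reall phase curves in `D = 5`: three stationary vacuum black holes with the same `j` -/

/-- **The reduced spin of the balanced black ring**: `j² = (1+ν)³/(8ν)` as a function of the
thickness parameter `ν ∈ (0, 1)` (thin rings `0 < ν < 1/2`, fat rings `1/2 ≤ ν < 1`), from the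
parametric phase curve "`a_H = 2√(ν(1−ν))`, `j = √((1+ν)³/(8ν))`" of Emparan–Reall.
[cite: EmparanReall2008, §5.1.1 p. 14] -/
def blackRingSpinSq (ν : ℝ) : ℝ := (1 + ν) ^ 3 / (8 * ν)

/-- **The reduced horizon area of the balanced black ring**: `a_H = 2√(ν(1−ν))`.
[cite: EmparanReall2008, §5.1.1 p. 14] -/
def blackRingArea (ν : ℝ) : ℝ := 2 * Real.sqrt (ν * (1 - ν))

/-- **The reduced spin of the singly spinning `D = 5` Myers–Perry black hole**:
`j² = 1/(1+ν²)` in terms of the shape parameter `ν = r₀/a ∈ (0, ∞)` (Emparan–Reall, §4.1,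
eq. for `j^{d−3}` with `d = 5`: the prefactor `(π/(d−3)^{(d−3)/2}) Ω_{d−3}/Ω_{d−2}` equals
`(π/2)(4π/2π²) = 1`; likewise `a_H² = 8ν²/(1+ν²)`). In particular `j² < 1` for every
Myers–Perry hole and every `j² ∈ (0,1)` occurs. [cite: EmparanReall2008, §4.1 p. 11] [cite: MyersPerry1986] -/
def myersPerrySpinSq (ν : ℝ) : ℝ := 1 / (1 + ν ^ 2)

/-- The cusp of the ring curve: `j²(1/2) = 27/32` ("a cusp at `ν = 1/2`, which corresponds to a
minimum value of `j = √(27/32)`"). [cite: EmparanReall2008, §5.1.1 p. 14] -/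
lemma blackRingSpinSq_half : blackRingSpinSq (1 / 2) = 27 / 32 := by norm_num [blackRingSpinSq]

/-- The fat branch ends at `j² (1) = 1` ("extends only to `j → 1`, ending at `ν → 1`").
[cite: EmparanReall2008, §5.1.1 p. 14] -/
lemma blackRingSpinSq_one : blackRingSpinSq 1 = 1 := by norm_num [blackRingSpinSq]

/-- A thin-ring value: `j²(1/8) = 729/512 > 1`. [folklore] -/
lemma blackRingSpinSq_eighth : blackRingSpinSq (1 / 8) = 729 / 512 := by
  norm_num [blackRingSpinSq]

/-- The ring curve is continuous on `ν > 0`. [folklore] -/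
lemma continuousOn_blackRingSpinSq : ContinuousOn blackRingSpinSq (Ioi 0) := by
  unfold blackRingSpinSq
  fun_prop (disch := intro x hx; exact mul_ne_zero (by norm_num) (ne_of_gt hx))

/-- **Non-uniqueness in `D = 5` at the level of the printed phase curves (proved):** "in the
range `√(27/32) ≤ j < 1` there exist three different solutions (thin and fat black rings, and
MP black hole) with the same value of `j`" (Emparan–Reall 2008, §5.1.1, p. 14) — for every
`27/32 < j² < 1` there are a thin-ring parameter `ν₁ ∈ (0, 1/2)`, a fat-ring parameter
`ν₂ ∈ (1/2, 1)` and a Myers–Perry parameter `ν₃ > 0` realising `j²` on the respective curves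
`blackRingSpinSq`, `myersPerrySpinSq` (intermediate value theorem; at the cusp `j² = 27/32`
the two ring branches coincide, whence the open range). That the three parameter values are
three distinct regular asymptotically flat stationary vacuum black holes of the same mass and
angular momentum (horizon topologies `S¹ × S²`, `S¹ × S²`, `S³`) is the cited physics, not
formalised. [cite: EmparanReall2008, §5.1.1 p. 14] [cite: EmparanReall2002] -/
theorem blackRing_nonuniqueness {jsq : ℝ} (h1 : 27 / 32 < jsq) (h2 : jsq < 1) :
    ∃ ν₁ ∈ Ioo (0 : ℝ) (1 / 2), ∃ ν₂ ∈ Ioo (1 / 2 : ℝ) 1,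
      blackRingSpinSq ν₁ = jsq ∧ blackRingSpinSq ν₂ = jsq ∧
        ∃ ν₃ : ℝ, 0 < ν₃ ∧ myersPerrySpinSq ν₃ = jsq := by
  have hc1 : ContinuousOn blackRingSpinSq (Icc (1 / 8 : ℝ) (1 / 2)) :=
    continuousOn_blackRingSpinSq.mono fun x hx ↦ lt_of_lt_of_le (by norm_num) hx.1
  have hc2 : ContinuousOn blackRingSpinSq (Icc (1 / 2 : ℝ) 1) :=
    continuousOn_blackRingSpinSq.mono fun x hx ↦ lt_of_lt_of_le (by norm_num) hx.1
  -- thin branch: `j²` decreases through `jsq` on `[1/8, 1/2]`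
  have hmem1 : jsq ∈ Icc (blackRingSpinSq (1 / 2)) (blackRingSpinSq (1 / 8)) := by
    rw [blackRingSpinSq_half, blackRingSpinSq_eighth]
    exact ⟨h1.le, by linarith⟩
  obtain ⟨ν₁, hν₁, hf₁⟩ := intermediate_value_Icc' (by norm_num) hc1 hmem1
  -- fat branch: `j²` increases through `jsq` on `[1/2, 1]`
  have hmem2 : jsq ∈ Icc (blackRingSpinSq (1 / 2)) (blackRingSpinSq 1) := by
    rw [blackRingSpinSq_half, blackRingSpinSq_one]
    exact ⟨h1.le, h2.le⟩
  obtain ⟨ν₂, hν₂, hf₂⟩ := intermediate_value_Icc (by norm_num) hc2 hmem2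
  have hν₁' : ν₁ ≠ 1 / 2 := by
    rintro rfl
    rw [blackRingSpinSq_half] at hf₁
    linarith
  have hν₂' : ν₂ ≠ 1 / 2 := by
    rintro rfl
    rw [blackRingSpinSq_half] at hf₂
    linarith
  have hν₂'' : ν₂ ≠ 1 := by
    rintro rfl
    rw [blackRingSpinSq_one] at hf₂
    linarith
  refine ⟨ν₁, ⟨lt_of_lt_of_le (by norm_num) hν₁.1, lt_of_le_of_ne hν₁.2 hν₁'⟩, ν₂,
    ⟨lt_of_le_of_ne hν₂.1 (Ne.symm hν₂'), lt_of_le_of_ne hν₂.2 hν₂''⟩, hf₁, hf₂, ?_⟩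
  have hj : 0 < jsq := by linarith
  have hnn : 0 < 1 / jsq - 1 := by
    rw [sub_pos, lt_div_iff₀ hj]
    linarith
  refine ⟨Real.sqrt (1 / jsq - 1), Real.sqrt_pos.2 hnn, ?_⟩
  rw [myersPerrySpinSq, Real.sq_sqrt hnn.le]
  field_simp
  ring

end Literature.Barriers.FinalStateConjecture

end
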